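import Summits.Langlands.Langlands.Theses.RamifiedCoefficientSeed
import Literature.NumberTheory.PAdicHodge.BdRDataNonempty
import Literature.NumberTheory.GaloisRepresentations.LocalGaloisGroupProofs

/-!
# `ExplicitRamifiedFamily` (stmt-Langlands-16778) — negative knowledge I: the pin is load-bearing

From the standing disprover's `Cruxes/ExplicitRamifiedFamily/Disproof.lean` (cdisprove cycle 1, seat
`refuter-cdisprove-stmt-Langlands-16778-0`, 2026-08-17).  Sorry-free; axioms `propext`, `Classical.choice`,
`Quot.sound`.  Nothing here refutes the item; it records, kernel-checked, WHY the item can be neither proved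
nor refuted in the tree as typed, by exhibiting an admissible re-pinning of its local `p`-adic Hodge datum at
which the statement is false.

The crux (route `RamifiedCoefficientSeed`, `h1` of `closes`) asserts `∃ p ≥ 11, ∃ f : ℕ → (Γ_ℚ → GL₃(ℚ̄_p))`
with, for every member, the clause (C) "`D.IsCrystallineFramed ((f n).toLocal v)` and labelled Hodge–Tate
weights `{0,1,2}` for `D := fontainePstAdicCompletion v p hv`", the ε-PINNED datum
(`fontainePst = (Classical.epsilon over {𝔇 // 𝔇.algebra = canonical ∧ 𝔇.𝔅 = bdRPeriodRingData}) …`).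

* `badWD F p n` — the Weil–Deligne representation `(diag(q^{deg w}, 1, …, 1), N = E₀₁)` over `ℚ̄_p`:
  unramified Weil action, NON-ZERO monodromy in rank `3` (`badWD_N_three_ne_zero`).
* `advDatum hp` — a `PstWeilDeligneData F p` with the given `ℚ_p`-structure and period ring
  `bdRPeriodRingData hp` (so `advDatum_mem_subtype`: it is a point of the subtype ε ranges over), whose
  Weil–Deligne half is `(ρ|_{W_F}, 0)` on unramified `ρ` (forced by the structure axioms) and `badWD` on every
  other `ρ`; the five structure axioms are theorems (as for the accepted `nonempty_pstWeilDeligneData_bdR`).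
  Hence `isLocallyUnramified_of_isCrystallineFramed_advDatum`: crystalline for `advDatum` ⇒ unramified.
* `advDatumAt p v hv` — its specialisation to `ℚ_v`, `v ∣ p`, built ON THE PIN'S OWN algebra and period
  ring: `advDatumAt_algebra` (`rfl`) and `advDatumAt_𝔅` (both period rings are Fontaine's `B_dR(ℚ_v)`,
  `fontainePstAdicCompletion_𝔅_eq_bdRPeriodRingData`), so `isDeRhamFramed_advDatumAt_iff`: de Rham-ness and
  every labelled-weights clause read the same for the two data; they differ ONLY in `IsWeilDeligneOf`.
* `not_explicitRamifiedFamily_at_advDatumAt` — **the crux's statement with `fontainePstAdicCompletion v p hv`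
  replaced by `advDatumAt p v hv` (and nothing else changed) is FALSE**, modulo the hypothesis `hW`:
  "a rank-3 `ρ : Γ_ℚ → GL₃(ℚ̄_p)` unramified at `v ∣ p` does not have labelled weights `{0,1,2}` for the
  pinned datum" — Fontaine's theorem "unramified ⇒ all Hodge–Tate weights `0`" (Astérisque 223, Exp. III §5)
  in LABELLED form for the genuine `B_dR(ℚ_v)` (in the tree: unlabelled, `hodgeTateWeights_bdR_of_unramified`;
  labelled for the trivial representation, `fontainePst_labelledHodgeTateWeights_one`).

READING.  The accepted constraints on the pin's Weil–Deligne half — the structure axioms of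
`PstWeilDeligneData` and, under the named fact `FontaineDatumExists`, clauses (F1)–(F12) of `IsFontaineDatum`
— concern unramified representations, cyclotomic powers, determinants on inertia and Kisin-ring points; none
forces `N = 0` (or `N ≠ 0`) on a ramified weight-`{0,1,2}` representation.  So no accepted fact separates the
pinned evaluation (= the crux) from the adversarial one on such a member: conjunct (C1) `IsCrystallineFramed`
is the load-bearing and formally undetermined conjunct — underivable for every candidate member, irrefutable
for every candidate member.  The arithmetic content (crux minus (C1)) is an open existence problem, believed
true (see `Disproof.lean` §4, §7).  Planner repair: re-type (C) datum-free (strategist's R1, ordinary branch)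
or over explicit family data (R2).
[cite: FontaineAsterisque223III, Exp. III §5] [folklore]
-/

set_option linter.dupNamespace false -- project-wide option; `Summit.Langlands.Langlands` is the mandated namespace

noncomputable section

namespace Summit.Langlands.Langlands.Theorems.ExplicitRamifiedFamily.Negative

open Literature.NumberTheory.GaloisRepresentations
open Literature.NumberTheory.GaloisRepresentations.IsNonarchimedeanLocalField
open Literature.NumberTheory.PAdicHodge
open Field ValuativeRel WeilGroup Filter
open scoped MatrixGroups

section BadWD

variable {F : Type} [Field F] [ValuativeRel F] [TopologicalSpace F] [IsNonarchimedeanLocalField F]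
  {p : ℕ} [Fact p.Prime]

/-- The diagonal matrix `diag(q^{deg w}, 1, …, 1)` (entry `q^{deg w}` at the index of value `0`). [folklore] -/
def badDiag (n : ℕ) (w : WeilGroup F) : Matrix (Fin n) (Fin n) (PadicAlgCl p) :=
  Matrix.diagonal fun i => if i.val = 0 then ((residueFieldCard F : PadicAlgCl p) ^ (deg w)) else 1

/-- The nilpotent matrix with a single entry `1` at position `(0, 1)` (zero if `n ≤ 1`). [folklore] -/
def badNil (n : ℕ) : Matrix (Fin n) (Fin n) (PadicAlgCl p) :=
  Matrix.of fun i j => if i.val = 0 ∧ j.val = 1 then 1 else 0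

/-- `badDiag n 1 = 1` (`deg 1 = 0`). [folklore] -/
theorem badDiag_one (n : ℕ) : badDiag (F := F) (p := p) n 1 = 1 := by
  unfold badDiag
  rw [deg_one IsFrobPow.mul_holds IsFrobPow.unique_holds, zpow_zero]
  convert Matrix.diagonal_one with i
  split_ifs <;> rfl

/-- `badDiag` is multiplicative (`deg` is a homomorphism, `q ≠ 0`). [folklore] -/
theorem badDiag_mul (n : ℕ) (w w' : WeilGroup F) :
    badDiag (F := F) (p := p) n (w * w') = badDiag n w * badDiag n w' := by
  unfold badDiag
  rw [Matrix.diagonal_mul_diagonal, deg_mul IsFrobPow.mul_holds IsFrobPow.unique_holds]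
  congr 1
  funext i
  split_ifs with h
  · exact zpow_add₀ (by exact_mod_cast residueFieldCard_ne_zero F) _ _
  · rw [mul_one]

/-- `badDiag` is trivial on inertia (`deg = 0` there). [folklore] -/
theorem badDiag_of_mem_inertia (n : ℕ) {u : WeilGroup F} (hu : u ∈ inertia F) :
    badDiag (F := F) (p := p) n u = 1 := by
  unfold badDiag
  rw [(deg_eq_zero_iff_mem_inertia IsFrobPow.mul_holds IsFrobPow.unique_holds).2 hu, zpow_zero]
  convert Matrix.diagonal_one with i
  split_ifs <;> rfl

/-- The Weil–Deligne relation at matrix level: `D(w) E₀₁ = q^{deg w} • E₀₁ D(w)`. [folklore] -/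
theorem badDiag_mul_badNil (n : ℕ) (w : WeilGroup F) :
    badDiag (F := F) (p := p) n w * badNil n =
      ((residueFieldCard F : PadicAlgCl p) ^ (deg w)) • (badNil n * badDiag n w) := by
  ext i j
  simp only [badDiag, badNil, Matrix.diagonal_mul, Matrix.mul_diagonal, Matrix.of_apply,
    Matrix.smul_apply, smul_eq_mul]
  by_cases h : i.val = 0 ∧ j.val = 1
  · rw [if_pos h, if_pos h.1, if_neg (show ¬ (j.val = 0) by omega)]
    ring
  · rw [if_neg h]
    ring

/-- `E₀₁² = 0`. [folklore] -/
theorem badNil_mul_badNil (n : ℕ) : badNil (p := p) n * badNil n = 0 := by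
  ext i j
  simp only [badNil, Matrix.mul_apply, Matrix.of_apply, Matrix.zero_apply]
  refine Finset.sum_eq_zero fun k _ => ?_
  by_cases h1 : i.val = 0 ∧ k.val = 1
  · rw [if_pos h1, if_neg (show ¬ (k.val = 0 ∧ j.val = 1) by omega), mul_zero]
  · rw [if_neg h1, zero_mul]

variable (F p) in
/-- The unramified character `w ↦ diag(q^{deg w}, 1, …, 1)` of `W_F` on `ℚ̄_pⁿ`. [folklore] -/
def badRep (n : ℕ) : Representation (PadicAlgCl p) (WeilGroup F) (Fin n → PadicAlgCl p) where
  toFun w := Matrix.toLin' (badDiag n w)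
  map_one' := by rw [badDiag_one, Matrix.toLin'_one]; rfl
  map_mul' w w' := by rw [badDiag_mul, Matrix.toLin'_mul, Module.End.mul_eq_comp]

/-- Unfolding lemma for `badRep`. [folklore] -/
theorem badRep_apply (n : ℕ) (w : WeilGroup F) : badRep F p n w = Matrix.toLin' (badDiag n w) := rfl

/-- `badRep` is an unramified representation of `W_F`. [folklore] -/
theorem isUnramifiedRep_badRep (n : ℕ) : IsUnramifiedRep (badRep F p n) := by
  intro u hu
  rw [badRep_apply, badDiag_of_mem_inertia n hu, Matrix.toLin'_one]
  rfl

variable (F p) in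
/-- **The "bad" Weil–Deligne representation** `(diag(q^{deg}, 1, …, 1), N = E₀₁)`: unramified Weil
action, NON-ZERO monodromy as soon as `n ≥ 2` (a `Sp(2) ⊕ 1^{n-2}`-shaped object). [folklore] -/
def badWD (n : ℕ) : WeilDeligneRep F (PadicAlgCl p) (Fin n → PadicAlgCl p) where
  ρ := badRep F p n
  isContinuous := (isUnramifiedRep_badRep n).isContinuousRep
  N := Matrix.toLin' (badNil n)
  isNilpotent_N := ⟨2, by rw [pow_two, Module.End.mul_eq_comp, ← Matrix.toLin'_mul, badNil_mul_badNil, map_zero]⟩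
  conj_N w := by
    rw [badRep_apply, ← Matrix.toLin'_mul, badDiag_mul_badNil, map_smul, Matrix.toLin'_mul]

/-- Unfolding lemma for the monodromy of `badWD`. [folklore] -/
theorem badWD_N (n : ℕ) : (badWD F p n).N = Matrix.toLin' (badNil n) := rfl

/-- For `n = 3` the monodromy of `badWD` is non-zero: `N e₁ = e₀`. [folklore] -/
theorem badWD_N_three_ne_zero : (badWD F p 3).N ≠ 0 := by
  intro h
  have h1 := congrArg (fun f : (Fin 3 → PadicAlgCl p) →ₗ[PadicAlgCl p] (Fin 3 → PadicAlgCl p) =>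
    f (Pi.single 1 1) 0) h
  simp only [badWD_N, Matrix.toLin'_apply, Matrix.mulVec_single_one, LinearMap.zero_apply,
    Pi.zero_apply, Matrix.col_apply, badNil, Matrix.of_apply] at h1
  simp at h1

/-- A Weil–Deligne representation isomorphic to `badWD F p 3` has non-zero monodromy. [folklore] -/
theorem N_ne_zero_of_equiv_badWD {V : Type*} [AddCommGroup V] [Module (PadicAlgCl p) V]
    {r : WeilDeligneRep F (PadicAlgCl p) V} (e : r.Equiv (badWD F p 3)) : r.N ≠ 0 := by
  intro hN
  apply badWD_N_three_ne_zero (F := F) (p := p)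
  have h0 : (badWD F p 3).N ∘ₗ e.toRepEquiv.toIntertwiningMap.toLinearMap = 0 := by
    rw [← e.comm_N, hN, LinearMap.comp_zero]
  refine LinearMap.ext fun x => ?_
  obtain ⟨y, rfl⟩ := e.toRepEquiv.toLinearEquiv.surjective x
  have := LinearMap.congr_fun h0 y
  rw [LinearMap.comp_apply, LinearMap.zero_apply] at this
  rw [LinearMap.zero_apply]
  exact this

end BadWD

section Datum

variable {F : Type} [Field F] [ValuativeRel F] [TopologicalSpace F] [IsNonarchimedeanLocalField F]
  {p : ℕ} [Fact p.Prime]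
variable [CharZero F] [Fact (¬ IsUnit (p : integerC F))]
  [IsAdicComplete (Ideal.span {(p : integerC F)}) (integerC F)] [Algebra ℚ_[p] F]

-- Mathlib's own global value of `maxSynthPendingDepth`.
set_option maxSynthPendingDepth 3 in
/-- **The adversarial datum on `B_dR(F)`**: canonical (given) `ℚ_p`-structure, period ring
`bdRPeriodRingData hp` — so it lies in the subtype Hilbert's `ε` ranges over in `fontainePst` — and the
ADVERSARIAL Weil–Deligne relation: unramified `ρ ↦ (ρ|_{W_F}, 0)` (forced by the structure axioms), every
OTHER `ρ ↦ badWD` (non-zero monodromy in rank `3`).  All five structure axioms are theorems (same proofs as the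
accepted `nonempty_pstWeilDeligneData_bdR`, whose ramified branch was the trivial representation). [folklore] -/
def advDatum (hp : valuation F p < 1) : PstWeilDeligneData F p where
  algebra := ‹Algebra ℚ_[p] F›
  𝔅 := bdRPeriodRingData (F := F) (p := p) hp
  IsWeilDeligneOf := fun {n} ρ r =>
    (ρ.IsLocallyUnramified ∧ r.N = 0 ∧ Nonempty (Representation.Equiv r.ρ (ρ.weilRestrict F))) ∨
      (¬ ρ.IsLocallyUnramified ∧ r.IsEquivalent (badWD F p n))
  exists_of_isDeRham := by
    intro n ρ _
    by_cases hu : ρ.IsLocallyUnramified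
    · exact ⟨WeilDeligneRep.ofRep (ρ.weilRestrict F) hu.isUnramifiedRep_weilRestrict.isContinuousRep,
        Or.inl ⟨hu, rfl, ⟨Representation.Equiv.refl _⟩⟩⟩
    · exact ⟨badWD F p n, Or.inr ⟨hu, WeilDeligneRep.IsEquivalent.refl _⟩⟩
  isEquivalent := by
    intro n ρ r r' h h'
    rcases h with ⟨hu, hN, ⟨e⟩⟩ | ⟨hu, ⟨e⟩⟩
    · rcases h' with ⟨_, hN', ⟨e'⟩⟩ | ⟨hu', _⟩
      · exact ⟨{ toRepEquiv := e.trans e'.symm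
                 comm_N := by rw [hN, hN', LinearMap.comp_zero, LinearMap.zero_comp] }⟩
      · exact absurd hu hu'
    · rcases h' with ⟨hu', _, _⟩ | ⟨_, he'⟩
      · exact absurd hu' hu
      · exact (show r.IsEquivalent (badWD F p n) from ⟨e⟩).trans he'.symm
  conj := by
    intro n g ρ r h
    rcases h with ⟨hu, hN, ⟨e⟩⟩ | ⟨hu, he⟩
    · exact Or.inl ⟨(FramedRep.isLocallyUnramified_conj_iff g ρ).2 hu, hN,
        ⟨e.trans (FramedRep.weilRestrictConjEquiv g ρ)⟩⟩
    · exact Or.inr ⟨fun h => hu ((FramedRep.isLocallyUnramified_conj_iff g ρ).1 h), he⟩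
  isDeRhamWith_of_isLocallyUnramified := fun ρ h => ρ.isDeRhamWith_bdR_of_isLocallyUnramified hp h
  wd_of_isLocallyUnramified := by
    intro n ρ r hρ h
    rcases h with ⟨_, hN, ⟨e⟩⟩ | ⟨hu, _⟩
    · refine ⟨hN, fun u hu => LinearMap.ext fun v => ?_⟩
      have h1 := Representation.IntertwiningMap.isIntertwining _ _ e.toIntertwiningMap u v
      rw [hρ.isUnramifiedRep_weilRestrict u hu] at h1
      exact e.injective h1
    · exact absurd hρ hu

/-- `advDatum` lies in the subtype Hilbert's `ε` ranges over in `fontainePst`: given `ℚ_p`-structure,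
period ring `bdRPeriodRingData hp` (literally the predicate of `nonempty_pstWeilDeligneData_bdR`). [folklore] -/
theorem advDatum_mem_subtype (hp : valuation F p < 1) :
    (advDatum (F := F) (p := p) hp).algebra = ‹Algebra ℚ_[p] F› ∧
      (advDatum (F := F) (p := p) hp).𝔅 =
        (letI := (advDatum (F := F) (p := p) hp).algebra; bdRPeriodRingData (F := F) (p := p) hp) :=
  ⟨rfl, rfl⟩

/-- **Under the adversarial datum, pinned-crystalline rank-3 representations are unramified.** [folklore] -/
theorem isLocallyUnramified_of_isCrystallineFramed_advDatum (hp : valuation F p < 1)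
    (ρ : FramedRep (absoluteGaloisGroup F) (PadicAlgCl p) 3)
    (h : (advDatum (F := F) (p := p) hp).IsCrystallineFramed ρ) : ρ.IsLocallyUnramified := by
  obtain ⟨-, r, hr, hN, -⟩ := h
  rcases hr with ⟨hu, -, -⟩ | ⟨-, ⟨e⟩⟩
  · exact hu
  · exact absurd hN (N_ne_zero_of_equiv_badWD e)

end Datum

section Global

/-- **The adversarial datum at the places of `ℚ` above `p`**, built on the PIN's own `ℚ_p`-structure (hence,
provably, on the same period ring `B_dR(ℚ_v)`): the pin with its Weil–Deligne half replaced adversarially.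
[folklore] -/
def advDatumAt (p : ℕ) [Fact p.Prime]
    (v : IsDedekindDomain.HeightOneSpectrum (NumberField.RingOfIntegers ℚ))
    (hv : ((p : ℕ) : NumberField.RingOfIntegers ℚ) ∈ v.asIdeal) :
    PstWeilDeligneData (v.adicCompletion ℚ) p :=
  haveI := LocalField.charZero_adicCompletion v
  letI : Algebra ℚ_[p] (v.adicCompletion ℚ) := (fontainePstAdicCompletion v p hv).algebra
  haveI : Fact (¬ IsUnit ((p : ℕ) : integerC (v.adicCompletion ℚ))) :=
    ⟨not_isUnit_natCast_integerC (LocalField.valuation_adicCompletion_natCast_lt_one v p hv)⟩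
  haveI : IsAdicComplete (Ideal.span {((p : ℕ) : integerC (v.adicCompletion ℚ))})
      (integerC (v.adicCompletion ℚ)) :=
    isAdicComplete_integerC_natCast (LocalField.valuation_adicCompletion_natCast_lt_one v p hv)
  advDatum (LocalField.valuation_adicCompletion_natCast_lt_one v p hv)

variable (p : ℕ) [Fact p.Prime] (v : IsDedekindDomain.HeightOneSpectrum (NumberField.RingOfIntegers ℚ))
  (hv : ((p : ℕ) : NumberField.RingOfIntegers ℚ) ∈ v.asIdeal)

/-- Same `ℚ_p`-structure as the pin (by construction). [folklore] -/
theorem advDatumAt_algebra : (advDatumAt p v hv).algebra = (fontainePstAdicCompletion v p hv).algebra := rfl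

/-- Same period ring as the pin: both are Fontaine's `B_dR(ℚ_v)` (`fontainePstAdicCompletion_𝔅_eq_bdRPeriodRingData`,
unconditional). [folklore] -/
theorem advDatumAt_𝔅 : (advDatumAt p v hv).𝔅 = (fontainePstAdicCompletion v p hv).𝔅 := by
  haveI := LocalField.charZero_adicCompletion v
  haveI : Fact (¬ IsUnit ((p : ℕ) : integerC (v.adicCompletion ℚ))) :=
    ⟨not_isUnit_natCast_integerC (LocalField.valuation_adicCompletion_natCast_lt_one v p hv)⟩
  haveI : IsAdicComplete (Ideal.span {((p : ℕ) : integerC (v.adicCompletion ℚ))})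
      (integerC (v.adicCompletion ℚ)) :=
    isAdicComplete_integerC_natCast (LocalField.valuation_adicCompletion_natCast_lt_one v p hv)
  rw [fontainePstAdicCompletion_𝔅_eq_bdRPeriodRingData v p hv]
  rfl

/-- De Rham-ness reads the same for the two data (it only sees `algebra` and `𝔅`). [folklore] -/
theorem isDeRhamFramed_advDatumAt_iff {n : ℕ}
    (ρ : FramedRep (absoluteGaloisGroup (v.adicCompletion ℚ)) (PadicAlgCl p) n) :
    (advDatumAt p v hv).IsDeRhamFramed ρ ↔ (fontainePstAdicCompletion v p hv).IsDeRhamFramed ρ := by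
  unfold PstWeilDeligneData.IsDeRhamFramed
  rw [advDatumAt_𝔅]
  rfl

/-- **Under the adversarial datum, pinned-crystalline rank-3 local representations are unramified.** [folklore] -/
theorem isLocallyUnramified_of_isCrystallineFramed_advDatumAt
    (ρ : FramedRep (absoluteGaloisGroup (v.adicCompletion ℚ)) (PadicAlgCl p) 3)
    (h : (advDatumAt p v hv).IsCrystallineFramed ρ) : ρ.IsLocallyUnramified := by
  haveI := LocalField.charZero_adicCompletion v
  letI : Algebra ℚ_[p] (v.adicCompletion ℚ) := (fontainePstAdicCompletion v p hv).algebra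
  haveI : Fact (¬ IsUnit ((p : ℕ) : integerC (v.adicCompletion ℚ))) :=
    ⟨not_isUnit_natCast_integerC (LocalField.valuation_adicCompletion_natCast_lt_one v p hv)⟩
  haveI : IsAdicComplete (Ideal.span {((p : ℕ) : integerC (v.adicCompletion ℚ))})
      (integerC (v.adicCompletion ℚ)) :=
    isAdicComplete_integerC_natCast (LocalField.valuation_adicCompletion_natCast_lt_one v p hv)
  exact isLocallyUnramified_of_isCrystallineFramed_advDatum
    (LocalField.valuation_adicCompletion_natCast_lt_one v p hv) ρ h

omit [Fact p.Prime] in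
/-- Over `ℚ` there is a finite place above every prime `p`. [folklore] -/
theorem exists_heightOneSpectrum_mem [hp : Fact p.Prime] :
    ∃ v : IsDedekindDomain.HeightOneSpectrum (NumberField.RingOfIntegers ℚ),
      ((p : ℕ) : NumberField.RingOfIntegers ℚ) ∈ v.asIdeal := by
  refine ⟨Rat.HeightOneSpectrum.primesEquiv.symm ⟨p, hp.out⟩, ?_⟩
  change ((p : ℕ) : NumberField.RingOfIntegers ℚ) ∈
    (Ideal.span {((p : ℕ) : ℤ)}).map (Rat.IsIntegralClosure.intEquiv (NumberField.RingOfIntegers ℚ)).symm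
  have h : (Rat.IsIntegralClosure.intEquiv (NumberField.RingOfIntegers ℚ)).symm (p : ℤ) =
      ((p : ℕ) : NumberField.RingOfIntegers ℚ) := map_natCast _ p
  rw [← h]
  exact Ideal.mem_map_of_mem _ (Ideal.mem_span_singleton_self _)

end Global

/-- **MAIN.  The crux's statement evaluated at the adversarial datum is FALSE** — the text below is
`RamifiedCoefficientSeed.ExplicitRamifiedFamily` VERBATIM with the single substitution
`fontainePstAdicCompletion v p hv ↦ advDatumAt p v hv` (a datum with the same algebra and the same period ring,
differing only in its Weil–Deligne half) — modulo the hypothesis `hW`, Fontaine's "unramified ⇒ Hodge–Tate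
weights `0`" in labelled form for the pin's genuine `B_dR(ℚ_v)` (so that no locally-unramified rank-3 `ρ` has
pinned labelled weights `{0,1,2}`).  Proof: a member `f 0` is `advDatumAt`-crystalline at the place above `p`,
hence locally unramified there (`isLocallyUnramified_of_isCrystallineFramed_advDatumAt`), while its weights
clause — which reads the same for both data (`advDatumAt_𝔅`) — says `{0,1,2}`.
[cite: FontaineAsterisque223III, Exp. III §5] -/
theorem not_explicitRamifiedFamily_at_advDatumAt
    (hW : ∀ (p : ℕ) [Fact p.Prime] (ρ : FramedGaloisRep ℚ (PadicAlgCl p) 3)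
      (v : IsDedekindDomain.HeightOneSpectrum (NumberField.RingOfIntegers ℚ))
      (hv : ((p : ℕ) : NumberField.RingOfIntegers ℚ) ∈ v.asIdeal),
      (ρ.toLocal v).IsLocallyUnramified →
        letI := (fontainePstAdicCompletion v p hv).algebra
        ∃ τ : v.adicCompletion ℚ →ₐ[ℚ_[p]] PadicAlgCl p,
          ρ.labelledHodgeTateWeightsAt v (fontainePstAdicCompletion v p hv).algebra
            (fontainePstAdicCompletion v p hv).𝔅 τ.toRingHom ≠ {0, 1, 2}) :
    ¬ (∃ (p : ℕ) (_ : Fact p.Prime), 11 ≤ p ∧ ∃ f : ℕ → Literature.NumberTheory.GaloisRepresentations.FramedGaloisRep ℚ (PadicAlgCl p) 3, (∀ m n, m ≠ n → ¬ ∃ χ : Literature.NumberTheory.GaloisRepresentations.FramedGaloisRep ℚ (PadicAlgCl p) 1, ∀ σ, (f m σ).val.trace = (χ σ).val 0 0 * (f n σ).val.trace) ∧ ∀ n, (¬ ∃ χ : Literature.NumberTheory.GaloisRepresentations.FramedGaloisRep ℚ (PadicAlgCl p) 1, ∀ σ, (f n σ⁻¹).val.trace = (χ σ).val 0 0 * (f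 n σ).val.trace) ∧ (∀ᶠ v : IsDedekindDomain.HeightOneSpectrum (NumberField.RingOfIntegers ℚ) in Filter.cofinite, (f n).IsUnramifiedAt v) ∧ (∀ (v : IsDedekindDomain.HeightOneSpectrum (NumberField.RingOfIntegers ℚ)) (hv : ((p : ℕ) : NumberField.RingOfIntegers ℚ) ∈ v.asIdeal), let D := advDatumAt p v hv; D.IsCrystallineFramed ((f n).toLocal v) ∧ (letI := D.algebra; ∀ τ : v.adicCompletion ℚ →ₐ[ℚ_[p]] PadicAlgCl p, (f n).labelledHodgeTateWeightsAt v D.algebra D.𝔅 τ.toRingHom = {0, 1, 2})) ∧ (∃ ν : Literature.NumberTheory.GaloisRepresentations.FramedGaloisRep ℚ (PadicAlgCl p) 1, ∀ σ, ‖(f n σ).val.trace - (ν σ).val 0 0 * (f n σ⁻¹).val.trace‖ < 1) ∧ ((f n).restrictField (CyclotomicField p ℚ)).IsResiduallyAbsIrreducible ∧ (∃ (φ : ℚ →+* ℝ) (c : Field.absoluteGaloisGroup ℚ), Literature.NumberTheory.GaloisRepresentations.IsComplexConjugation φ c ∧ (((f n) c).val.trace = 1 ∨ ((f n) c).val.trace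 = -1))) := by
  rintro ⟨p, hp, -, f, -, hf⟩
  obtain ⟨-, -, hC, -, -, -⟩ := hf 0
  obtain ⟨v, hv⟩ := exists_heightOneSpectrum_mem p
  obtain ⟨hcr, hwt⟩ := hC v hv
  have hunr := isLocallyUnramified_of_isCrystallineFramed_advDatumAt p v hv _ hcr
  obtain ⟨τ, hτ⟩ := hW p (f 0) v hv hunr
  apply hτ
  have h𝔅 := advDatumAt_𝔅 p v hv
  have := hwt τ
  rw [h𝔅] at this
  exact this

/-- **Companion: the crux is the pinned evaluation of the same text** (`Iff.rfl` — recorded so that the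
substitution in `not_explicitRamifiedFamily_at_advDatumAt` can be checked mechanically against the route
declaration). [folklore] -/
theorem explicitRamifiedFamily_iff_pinned_text :
    Summit.Langlands.Langlands.Theses.RamifiedCoefficientSeed.ExplicitRamifiedFamily ↔
    (∃ (p : ℕ) (_ : Fact p.Prime), 11 ≤ p ∧ ∃ f : ℕ → Literature.NumberTheory.GaloisRepresentations.FramedGaloisRep ℚ (PadicAlgCl p) 3, (∀ m n, m ≠ n → ¬ ∃ χ : Literature.NumberTheory.GaloisRepresentations.FramedGaloisRep ℚ (PadicAlgCl p) 1, ∀ σ, (f m σ).val.trace = (χ σ).val 0 0 * (f n σ).val.trace) ∧ ∀ n, (¬ ∃ χ : Literature.NumberTheory.GaloisRepresentations.FramedGaloisRep ℚ (PadicAlgCl p) 1, ∀ σ, (f n σ⁻¹).val.trace = (χ σ).val 0 0 * (f n σ).val.trace) ∧ (∀ᶠ v : IsDedekindDomain.HeightOneSpectrum (NumberField.RingOfIntegers ℚ) in Filter.cofinite, (f n).IsUnramifiedAt v) ∧ (∀ (v : IsDedekindDomain.HeightOneSpectrum (NumberField.RingOfIntegers ℚ)) (hv : ((p : ℕ) :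 NumberField.RingOfIntegers ℚ) ∈ v.asIdeal), let D := fontainePstAdicCompletion v p hv; D.IsCrystallineFramed ((f n).toLocal v) ∧ (letI := D.algebra; ∀ τ : v.adicCompletion ℚ →ₐ[ℚ_[p]] PadicAlgCl p, (f n).labelledHodgeTateWeightsAt v D.algebra D.𝔅 τ.toRingHom = {0, 1, 2})) ∧ (∃ ν : Literature.NumberTheory.GaloisRepresentations.FramedGaloisRep ℚ (PadicAlgCl p) 1, ∀ σ, ‖(f n σ).val.trace - (ν σ).val 0 0 * (f n σ⁻¹).val.trace‖ < 1) ∧ ((f n).restrictField (CyclotomicField p ℚ)).IsResiduallyAbsIrreducible ∧ (∃ (φ : ℚ →+* ℝ) (c : Field.absoluteGaloisGroup ℚ), Literature.NumberTheory.GaloisRepresentations.IsComplexConjugation φ c ∧ (((f n) c).val.trace = 1 ∨ ((f n) c).val.trace = -1))) :=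
  Iff.rfl

end Summit.Langlands.Langlands.Theorems.ExplicitRamifiedFamily.Negative

end
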